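import Summits.CriticalPhenomena.Ising3D.ExclusionSentencesPiForms
import Mathlib.Analysis.PSeries
import Mathlib.NumberTheory.LSeries.RiemannZeta

/-!
# Certified enclosures of `ζ(3)` and `ζ(5)` (cell `pub-ising3x`, seat recog-1)

HONEST FRAMING: lottery ticket; floor = tightest certified 3D Ising CFT bounds; no exact-solution
claim without a proof.

Families `LIN` and `TRG` of the frozen list FAMILIES-v1 (`HOME/frozen/FAMILIES-v1.json`, SCOPE.md §3.1)
use the constants `π, π², π³, log 2, ζ(3), ζ(5), G` (LIN) and `L ∈ {log 2, ζ(3), ζ(5), G, e}` (TRG).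
`ExclusionSentencesPiForms(Lin).lean` put the `π / log 2 / e` parts in kernel form from Mathlib's certified
digits; Mathlib has no digits of `ζ(3)`, `ζ(5)` or Catalan's `G`.  This file supplies `ζ(3)` and `ζ(5)`,
proved from first principles (no numerics library, no `native_decide`); `ExclusionSentencesCatalan.lean`
does `G` with the same engine.
* `zeta3 = Σ_{k≥0} 1/(k+1)³`, `zeta5 = Σ_{k≥0} 1/(k+1)⁵`, with `(zeta3 : ℂ) = riemannZeta 3`,
  `(zeta5 : ℂ) = riemannZeta 5` (`zeta3_eq_riemannZeta`, `zeta5_eq_riemannZeta`);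
* `zeta3 ∈ [1.202056903159509, 1.202056903159597]` (`zeta3_mem_zeta3I`, width `8.8·10⁻¹⁴`),
  `zeta5 ∈ [1.036927755143367, 1.036927755143491]` (`zeta5_mem_zeta5I`, width `1.24·10⁻¹³`), as
  `ℚ × ℚ` pairs `zeta3I`, `zeta5I` for the interval arithmetic (`InI`) of `ExclusionSentencesPiForms.lean`.
Method — Kummer's telescoping acceleration made two-sided: 30 head terms are summed exactly; in the tail
(`n = m + 31`), with `e_j(n) = 1/∏_{i=-j}^{j}(n+i) = a_j(n) − a_j(n+1)`, `a_j(n) = 1/(2j·∏_{i=-j}^{j-1}(n+i))`: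
`1/n³ = e₁ − e₂ + 4e₃ − 36e₄ + 576 t₅` with `0 ≤ t₅ = 1/(n³∏_{j≤4}(n²−j²)) ≤ e₅`, and
`1/n⁵ = e₂ − 5e₃ + 49e₄ − r` with `0 ≤ r = 784 t₅ + 36/(n⁵∏_{j≤3}(n²−j²)) ≤ 820 e₅`.  So the tail lies
between the values at `m = 0` of two explicit potentials (`z3lo ≤ · ≤ z3hi`, `z5lo ≤ · ≤ z5hi`).  Each
termwise inequality is an identity of rational functions (`field_simp; ring`) whose slack is a manifestly
positive fraction; `tsum_bounds_of_telescoping` (partial sums → `tsum`, potentials → 0) does the rest, and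
`norm_num` evaluates the 30-term head sums.  Exact design / cross-check (Python `fractions` only):
`HOME/pub-ising3x-recog-1/lean/tools/zeta_catalan_design.py`.  No 3D digit is used anywhere.
-/

namespace Summit.CriticalPhenomena.Ising3D

open Filter Topology Finset

/-! ### Generic: two-sided bounds on a series from telescoping minorants / majorants -/

/-- If `Φlo m − Φlo (m+1) ≤ g m ≤ Φhi m − Φhi (m+1)` for all `m` and both potentials tend to `0`, then
`Φlo 0 ≤ Σ g ≤ Φhi 0`. -/
theorem tsum_bounds_of_telescoping {g Φlo Φhi : ℕ → ℝ} (hg : Summable g)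
    (hlo : ∀ m, Φlo m - Φlo (m + 1) ≤ g m) (hhi : ∀ m, g m ≤ Φhi m - Φhi (m + 1))
    (hl : Tendsto Φlo atTop (𝓝 0)) (hh : Tendsto Φhi atTop (𝓝 0)) :
    Φlo 0 ≤ ∑' m, g m ∧ ∑' m, g m ≤ Φhi 0 := by
  have hS := hg.hasSum.tendsto_sum_nat
  have h1 : ∀ n, Φlo 0 - Φlo n ≤ ∑ m ∈ range n, g m := by
    intro n
    induction n with
    | zero => simp
    | succ n ih => rw [sum_range_succ]; linarith [hlo n]
  have h2 : ∀ n, ∑ m ∈ range n, g m ≤ Φhi 0 - Φhi n := by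
    intro n
    induction n with
    | zero => simp
    | succ n ih => rw [sum_range_succ]; linarith [hhi n]
  have hl' : Tendsto (fun n => Φlo 0 - Φlo n) atTop (𝓝 (Φlo 0 - 0)) := tendsto_const_nhds.sub hl
  have hh' : Tendsto (fun n => Φhi 0 - Φhi n) atTop (𝓝 (Φhi 0 - 0)) := tendsto_const_nhds.sub hh
  rw [sub_zero] at hl' hh'
  exact ⟨le_of_tendsto_of_tendsto' hl' hS h1, le_of_tendsto_of_tendsto' hS hh' h2⟩

/-- Head + tail form: with `N` head terms summed, telescoping bounds for the tail `m ↦ f (m + N)` enclose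
the series. -/
theorem tsum_mem_of_telescoping {f Φlo Φhi : ℕ → ℝ} (N : ℕ) (hf : Summable f)
    (hlo : ∀ m, Φlo m - Φlo (m + 1) ≤ f (m + N)) (hhi : ∀ m, f (m + N) ≤ Φhi m - Φhi (m + 1))
    (hl : Tendsto Φlo atTop (𝓝 0)) (hh : Tendsto Φhi atTop (𝓝 0)) :
    ∑ k ∈ range N, f k + Φlo 0 ≤ ∑' k, f k ∧ ∑' k, f k ≤ ∑ k ∈ range N, f k + Φhi 0 := by
  have hsplit := hf.sum_add_tsum_nat_add N
  have hg : Summable (fun m => f (m + N)) := (summable_nat_add_iff N).mpr hf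
  obtain ⟨h1, h2⟩ := tsum_bounds_of_telescoping hg hlo hhi hl hh
  rw [← hsplit]
  exact ⟨by linarith, by linarith⟩

/-- `((m : ℝ) + s)⁻¹ → 0` along `m → ∞`. -/
theorem tendsto_inv_natCast_add (s : ℝ) : Tendsto (fun m : ℕ => ((m : ℝ) + s)⁻¹) atTop (𝓝 0) :=
  tendsto_inv_atTop_zero.comp (tendsto_atTop_add_const_right _ s tendsto_natCast_atTop_atTop)

/-! ### `ζ(3)` -/

/-- Apéry's constant `ζ(3) = Σ_{k≥0} 1/(k+1)³`. -/
noncomputable def zeta3 : ℝ := ∑' k : ℕ, 1 / ((k : ℝ) + 1) ^ 3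

/-- Summability of the terms of `zeta3`. -/
theorem summable_zeta3 : Summable (fun k : ℕ => 1 / ((k : ℝ) + 1) ^ 3) := by
  have h := (summable_nat_add_iff 1).mpr (Real.summable_one_div_nat_pow.mpr (by norm_num : 1 < 3))
  simpa [Nat.cast_add, Nat.cast_one] using h

/-- `zeta3` is the value of the Riemann zeta function at `3`. -/
theorem zeta3_eq_riemannZeta : (zeta3 : ℂ) = riemannZeta 3 := by
  have h := zeta_eq_tsum_one_div_nat_add_one_cpow (s := 3) (by norm_num)
  rw [h, zeta3, Complex.ofReal_tsum]
  refine tsum_congr fun k => ?_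
  rw [show (3 : ℂ) = ((3 : ℕ) : ℂ) by norm_num, Complex.cpow_natCast]
  push_cast
  ring

/-! Telescoping potentials for the tail after 30 head terms (`n = m + 31`):
`a_j = 1/(2j·∏_{i=-j}^{j-1}(n+i))`, shared by `zeta3` and `zeta5`. -/

/-- `a₁(n) = 1/(2(n−1)n)` at `n = m + 31`. -/
noncomputable def za1 (m : ℕ) : ℝ :=
  (1 : ℝ) / 2 * ((m : ℝ) + 30)⁻¹ * ((m : ℝ) + 31)⁻¹

/-- `a₂(n) = 1/(4(n−2)(n−1)n(n+1))` at `n = m + 31`. -/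
noncomputable def za2 (m : ℕ) : ℝ :=
  (1 : ℝ) / 4 * ((m : ℝ) + 29)⁻¹ * ((m : ℝ) + 30)⁻¹ * ((m : ℝ) + 31)⁻¹ * ((m : ℝ) + 32)⁻¹

/-- `a₃(n) = 1/(6∏_{i=-3}^{2}(n+i))` at `n = m + 31`. -/
noncomputable def za3 (m : ℕ) : ℝ :=
  (1 : ℝ) / 6 * ((m : ℝ) + 28)⁻¹ * ((m : ℝ) + 29)⁻¹ * ((m : ℝ) + 30)⁻¹ * ((m : ℝ) + 31)⁻¹ *
    ((m : ℝ) + 32)⁻¹ * ((m : ℝ) + 33)⁻¹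

/-- `a₄(n) = 1/(8∏_{i=-4}^{3}(n+i))` at `n = m + 31`. -/
noncomputable def za4 (m : ℕ) : ℝ :=
  (1 : ℝ) / 8 * ((m : ℝ) + 27)⁻¹ * ((m : ℝ) + 28)⁻¹ * ((m : ℝ) + 29)⁻¹ * ((m : ℝ) + 30)⁻¹ *
    ((m : ℝ) + 31)⁻¹ * ((m : ℝ) + 32)⁻¹ * ((m : ℝ) + 33)⁻¹ * ((m : ℝ) + 34)⁻¹

/-- `a₅(n) = 1/(10∏_{i=-5}^{4}(n+i))` at `n = m + 31`. -/
noncomputable def za5 (m : ℕ) : ℝ :=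
  (1 : ℝ) / 10 * ((m : ℝ) + 26)⁻¹ * ((m : ℝ) + 27)⁻¹ * ((m : ℝ) + 28)⁻¹ * ((m : ℝ) + 29)⁻¹ *
    ((m : ℝ) + 30)⁻¹ * ((m : ℝ) + 31)⁻¹ * ((m : ℝ) + 32)⁻¹ * ((m : ℝ) + 33)⁻¹ * ((m : ℝ) + 34)⁻¹ *
    ((m : ℝ) + 35)⁻¹

/-- Lower potential for the `zeta3` tail: `a₁ − a₂ + 4a₃ − 36a₄`. -/
noncomputable def z3lo (m : ℕ) : ℝ := za1 m - za2 m + 4 * za3 m - 36 * za4 m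

/-- Upper potential for the `zeta3` tail: `z3lo + 576 a₅`. -/
noncomputable def z3hi (m : ℕ) : ℝ := z3lo m + 576 * za5 m

/-- `za1 → 0`. -/
theorem tendsto_za1 : Tendsto za1 atTop (𝓝 0) := by
  have h :=
    (((tendsto_const_nhds (x := ((1 : ℝ) / 2))).mul (tendsto_inv_natCast_add (30 : ℝ))).mul
      (tendsto_inv_natCast_add (31 : ℝ)))
  simp only [mul_zero] at h
  exact h.congr' (Eventually.of_forall fun m => by simp only [za1])

/-- `za2 → 0`. -/
theorem tendsto_za2 : Tendsto za2 atTop (𝓝 0) := by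
  have h :=
    (((((tendsto_const_nhds (x := ((1 : ℝ) / 4))).mul (tendsto_inv_natCast_add (29 : ℝ))).mul
      (tendsto_inv_natCast_add (30 : ℝ))).mul (tendsto_inv_natCast_add (31 : ℝ))).mul
      (tendsto_inv_natCast_add (32 : ℝ)))
  simp only [mul_zero] at h
  exact h.congr' (Eventually.of_forall fun m => by simp only [za2])

/-- `za3 → 0`. -/
theorem tendsto_za3 : Tendsto za3 atTop (𝓝 0) := by
  have h :=
    (((((((tendsto_const_nhds (x := ((1 : ℝ) / 6))).mul (tendsto_inv_natCast_add (28 : ℝ))).mul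
      (tendsto_inv_natCast_add (29 : ℝ))).mul (tendsto_inv_natCast_add (30 : ℝ))).mul
      (tendsto_inv_natCast_add (31 : ℝ))).mul (tendsto_inv_natCast_add (32 : ℝ))).mul
      (tendsto_inv_natCast_add (33 : ℝ)))
  simp only [mul_zero] at h
  exact h.congr' (Eventually.of_forall fun m => by simp only [za3])

/-- `za4 → 0`. -/
theorem tendsto_za4 : Tendsto za4 atTop (𝓝 0) := by
  have h :=
    (((((((((tendsto_const_nhds (x := ((1 : ℝ) / 8))).mul
      (tendsto_inv_natCast_add (27 : ℝ))).mul (tendsto_inv_natCast_add (28 : ℝ))).mul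
      (tendsto_inv_natCast_add (29 : ℝ))).mul (tendsto_inv_natCast_add (30 : ℝ))).mul
      (tendsto_inv_natCast_add (31 : ℝ))).mul (tendsto_inv_natCast_add (32 : ℝ))).mul
      (tendsto_inv_natCast_add (33 : ℝ))).mul (tendsto_inv_natCast_add (34 : ℝ)))
  simp only [mul_zero] at h
  exact h.congr' (Eventually.of_forall fun m => by simp only [za4])

/-- `za5 → 0`. -/
theorem tendsto_za5 : Tendsto za5 atTop (𝓝 0) := by
  have h :=
    (((((((((((tendsto_const_nhds (x := ((1 : ℝ) / 10))).mul
      (tendsto_inv_natCast_add (26 : ℝ))).mul (tendsto_inv_natCast_add (27 : ℝ))).mul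
      (tendsto_inv_natCast_add (28 : ℝ))).mul (tendsto_inv_natCast_add (29 : ℝ))).mul
      (tendsto_inv_natCast_add (30 : ℝ))).mul (tendsto_inv_natCast_add (31 : ℝ))).mul
      (tendsto_inv_natCast_add (32 : ℝ))).mul (tendsto_inv_natCast_add (33 : ℝ))).mul
      (tendsto_inv_natCast_add (34 : ℝ))).mul (tendsto_inv_natCast_add (35 : ℝ)))
  simp only [mul_zero] at h
  exact h.congr' (Eventually.of_forall fun m => by simp only [za5])

/-- `z3lo → 0`. -/
theorem tendsto_z3lo : Tendsto z3lo atTop (𝓝 0) := by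
  have h := ((tendsto_za1.sub tendsto_za2).add (tendsto_za3.const_mul 4)).sub (tendsto_za4.const_mul 36)
  simp only [sub_zero, mul_zero, add_zero] at h
  exact h.congr' (Eventually.of_forall fun m => by simp only [z3lo])

/-- `z3hi → 0`. -/
theorem tendsto_z3hi : Tendsto z3hi atTop (𝓝 0) := by
  have h := tendsto_z3lo.add (tendsto_za5.const_mul 576)
  simp only [mul_zero, add_zero] at h
  exact h.congr' (Eventually.of_forall fun m => by simp only [z3hi])

/-- Termwise minorant `z3lo m − z3lo (m+1) ≤ 1/n³`: the slack is `576 t₅ ≥ 0`. -/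
theorem z3lo_step (m : ℕ) :
    z3lo m - z3lo (m + 1) ≤ 1 / (((m + 30 : ℕ) : ℝ) + 1) ^ 3 := by
  have key : 1 / (((m + 30 : ℕ) : ℝ) + 1) ^ 3 - (z3lo m - z3lo (m + 1)) =
      (576) /
      (((m : ℝ) + 27) * ((m : ℝ) + 28) * ((m : ℝ) + 29) * ((m : ℝ) + 30) * ((m : ℝ) + 31) ^ 3 *
        ((m : ℝ) + 32) * ((m : ℝ) + 33) * ((m : ℝ) + 34) * ((m : ℝ) + 35)) := by
    simp only [z3lo, za1, za2, za3, za4]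
    push_cast
    field_simp
    ring
  have : (0 : ℝ) ≤ (576) /
      (((m : ℝ) + 27) * ((m : ℝ) + 28) * ((m : ℝ) + 29) * ((m : ℝ) + 30) * ((m : ℝ) + 31) ^ 3 *
        ((m : ℝ) + 32) * ((m : ℝ) + 33) * ((m : ℝ) + 34) * ((m : ℝ) + 35)) := by
    positivity
  linarith

/-- Termwise majorant `1/n³ ≤ z3hi m − z3hi (m+1)`: the slack is `576 (e₅ − t₅) = 14400/(n³∏_{j≤5}(n²−j²))`. -/
theorem z3hi_step (m : ℕ) :
    1 / (((m + 30 : ℕ) : ℝ) + 1) ^ 3 ≤ z3hi m - z3hi (m + 1) := by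
  have key : z3hi m - z3hi (m + 1) - 1 / (((m + 30 : ℕ) : ℝ) + 1) ^ 3 =
      (14400) /
      (((m : ℝ) + 26) * ((m : ℝ) + 27) * ((m : ℝ) + 28) * ((m : ℝ) + 29) * ((m : ℝ) + 30) *
        ((m : ℝ) + 31) ^ 3 * ((m : ℝ) + 32) * ((m : ℝ) + 33) * ((m : ℝ) + 34) * ((m : ℝ) + 35) *
        ((m : ℝ) + 36)) := by
    simp only [z3hi, z3lo, za1, za2, za3, za4, za5]
    push_cast
    field_simp
    ring
  have : (0 : ℝ) ≤ (14400) /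
      (((m : ℝ) + 26) * ((m : ℝ) + 27) * ((m : ℝ) + 28) * ((m : ℝ) + 29) * ((m : ℝ) + 30) *
        ((m : ℝ) + 31) ^ 3 * ((m : ℝ) + 32) * ((m : ℝ) + 33) * ((m : ℝ) + 34) * ((m : ℝ) + 35) *
        ((m : ℝ) + 36)) := by
    positivity
  linarith

/-- The certified enclosure of `ζ(3)`: `[1.202056903159509, 1.202056903159597]`. -/
def zeta3I : ℚ × ℚ := (1202056903159509 / 10 ^ 15, 1202056903159597 / 10 ^ 15)

/-- **`ζ(3) ∈ zeta3I`** (thirty exact head terms + the telescoping tail bounds). -/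
theorem zeta3_mem_zeta3I : zeta3 ∈ InI zeta3I := by
  obtain ⟨h1, h2⟩ :=
    tsum_mem_of_telescoping 30 summable_zeta3 z3lo_step z3hi_step tendsto_z3lo tendsto_z3hi
  rw [← zeta3] at h1 h2
  norm_num [sum_range_succ, z3lo, z3hi, za1, za2, za3, za4, za5] at h1 h2
  refine ⟨?_, ?_⟩
  · simp only [zeta3I]; push_cast; linarith
  · simp only [zeta3I]; push_cast; linarith

/-! ### `ζ(5)` -/

/-- `ζ(5) = Σ_{k≥0} 1/(k+1)⁵`. -/
noncomputable def zeta5 : ℝ := ∑' k : ℕ, 1 / ((k : ℝ) + 1) ^ 5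

/-- Summability of the terms of `zeta5`. -/
theorem summable_zeta5 : Summable (fun k : ℕ => 1 / ((k : ℝ) + 1) ^ 5) := by
  have h := (summable_nat_add_iff 1).mpr (Real.summable_one_div_nat_pow.mpr (by norm_num : 1 < 5))
  simpa [Nat.cast_add, Nat.cast_one] using h

/-- `zeta5` is the value of the Riemann zeta function at `5`. -/
theorem zeta5_eq_riemannZeta : (zeta5 : ℂ) = riemannZeta 5 := by
  have h := zeta_eq_tsum_one_div_nat_add_one_cpow (s := 5) (by norm_num)
  rw [h, zeta5, Complex.ofReal_tsum]
  refine tsum_congr fun k => ?_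
  rw [show (5 : ℂ) = ((5 : ℕ) : ℂ) by norm_num, Complex.cpow_natCast]
  push_cast
  ring

/-- Upper potential for the `zeta5` tail: `a₂ − 5a₃ + 49a₄`. -/
noncomputable def z5hi (m : ℕ) : ℝ := za2 m - 5 * za3 m + 49 * za4 m

/-- Lower potential for the `zeta5` tail: `z5hi − 820 a₅`. -/
noncomputable def z5lo (m : ℕ) : ℝ := z5hi m - 820 * za5 m

/-- `z5hi → 0`. -/
theorem tendsto_z5hi : Tendsto z5hi atTop (𝓝 0) := by
  have h := (tendsto_za2.sub (tendsto_za3.const_mul 5)).add (tendsto_za4.const_mul 49)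
  simp only [sub_zero, mul_zero, add_zero] at h
  exact h.congr' (Eventually.of_forall fun m => by simp only [z5hi])

/-- `z5lo → 0`. -/
theorem tendsto_z5lo : Tendsto z5lo atTop (𝓝 0) := by
  have h := tendsto_z5hi.sub (tendsto_za5.const_mul 820)
  simp only [mul_zero, sub_zero] at h
  exact h.congr' (Eventually.of_forall fun m => by simp only [z5lo])

/-- Termwise majorant for `zeta5`: the slack is `784 t₅ + 36 u₄ = (820n² − 576)/(n⁵∏_{j≤4}(n²−j²)) ≥ 0`. -/
theorem z5hi_step (m : ℕ) :
    1 / (((m + 30 : ℕ) : ℝ) + 1) ^ 5 ≤ z5hi m - z5hi (m + 1) := by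
  have key : z5hi m - z5hi (m + 1) - 1 / (((m + 30 : ℕ) : ℝ) + 1) ^ 5 =
      (787444 + 50840 * (m : ℝ) + 820 * (m : ℝ) ^ 2) /
      (((m : ℝ) + 27) * ((m : ℝ) + 28) * ((m : ℝ) + 29) * ((m : ℝ) + 30) * ((m : ℝ) + 31) ^ 5 *
        ((m : ℝ) + 32) * ((m : ℝ) + 33) * ((m : ℝ) + 34) * ((m : ℝ) + 35)) := by
    simp only [z5hi, za2, za3, za4]
    push_cast
    field_simp
    ring
  have : (0 : ℝ) ≤ (787444 + 50840 * (m : ℝ) + 820 * (m : ℝ) ^ 2) /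
      (((m : ℝ) + 27) * ((m : ℝ) + 28) * ((m : ℝ) + 29) * ((m : ℝ) + 30) * ((m : ℝ) + 31) ^ 5 *
        ((m : ℝ) + 32) * ((m : ℝ) + 33) * ((m : ℝ) + 34) * ((m : ℝ) + 35)) := by
    positivity
  linarith

/-- Termwise minorant for `zeta5`: the slack is `820 e₅ − 784 t₅ − 36 u₄ = (21076n² − 14400)/(n⁵∏_{j≤5}(n²−j²)) ≥ 0`. -/
theorem z5lo_step (m : ℕ) :
    z5lo m - z5lo (m + 1) ≤ 1 / (((m + 30 : ℕ) : ℝ) + 1) ^ 5 := by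
  have key : 1 / (((m + 30 : ℕ) : ℝ) + 1) ^ 5 - (z5lo m - z5lo (m + 1)) =
      (20239636 + 1306712 * (m : ℝ) + 21076 * (m : ℝ) ^ 2) /
      (((m : ℝ) + 26) * ((m : ℝ) + 27) * ((m : ℝ) + 28) * ((m : ℝ) + 29) * ((m : ℝ) + 30) *
        ((m : ℝ) + 31) ^ 5 * ((m : ℝ) + 32) * ((m : ℝ) + 33) * ((m : ℝ) + 34) * ((m : ℝ) + 35) *
        ((m : ℝ) + 36)) := by
    simp only [z5lo, z5hi, za2, za3, za4, za5]
    push_cast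
    field_simp
    ring
  have : (0 : ℝ) ≤ (20239636 + 1306712 * (m : ℝ) + 21076 * (m : ℝ) ^ 2) /
      (((m : ℝ) + 26) * ((m : ℝ) + 27) * ((m : ℝ) + 28) * ((m : ℝ) + 29) * ((m : ℝ) + 30) *
        ((m : ℝ) + 31) ^ 5 * ((m : ℝ) + 32) * ((m : ℝ) + 33) * ((m : ℝ) + 34) * ((m : ℝ) + 35) *
        ((m : ℝ) + 36)) := by
    positivity
  linarith

/-- The certified enclosure of `ζ(5)`: `[1.036927755143367, 1.036927755143491]`. -/
def zeta5I : ℚ × ℚ := (1036927755143367 / 10 ^ 15, 1036927755143491 / 10 ^ 15)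

/-- **`ζ(5) ∈ zeta5I`.** -/
theorem zeta5_mem_zeta5I : zeta5 ∈ InI zeta5I := by
  obtain ⟨h1, h2⟩ :=
    tsum_mem_of_telescoping 30 summable_zeta5 z5lo_step z5hi_step tendsto_z5lo tendsto_z5hi
  rw [← zeta5] at h1 h2
  norm_num [sum_range_succ, z5lo, z5hi, za2, za3, za4, za5] at h1 h2
  refine ⟨?_, ?_⟩
  · simp only [zeta5I]; push_cast; linarith
  · simp only [zeta5I]; push_cast; linarith

end Summit.CriticalPhenomena.Ising3D
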